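import Summits.KontsevichZagierPeriods.KontsevichZagierPeriods.Theorems.ComplexOrientationsCauchyMoveBoundaryP

/-!
# Route `ComplexOrientations`, support item `CauchyMove` (stmt-KontsevichZagierPeriods-11370):
# the Cauchy move, part D5 — the `Im g · dv` half of the boundary

Helper file (prover-owned, `--supports CauchyMove`), continuing part D4. **Theorem `boundaryQ`**:
with `rQ = [ℝ, s ↦ −(Im g(γ s) · Im γ'(s))]` and `rd' = [τ, y ↦ Im g(b y, y) − Im g(−b y, y)]`,
`[rQ] + [rd'] ∈ KZ.relations` — split `ℝ = {s² ≤ 1} ∪ {s² ≥ 1}` (rule (1a)), substitute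
`y = Im γ(s)` on each piece (rule (2) via `cov1`; right half-circle for `s² ≤ 1`, left for
`s² ≥ 1`, whose image is `τ` minus the null point `y = 0`; images identified by `v_inv1`,
`v_inv2`), add on `τ` (rule (1b)) and compare with `rd'`.

Sources: Kontsevich–Zagier, *Periods* (2001), §1.2. Fully proved ([folklore]).
-/

noncomputable section

open MvPolynomial Set Metric MeasureTheory
open Literature.ModelTheory.ExponentialFields Literature.NumberTheory.Transcendental
open Literature.NumberTheory.Transcendental.KZ

namespace Summit.KontsevichZagierPeriods.ComplexOrientations.CauchyMoveAux

/-- The complex number `x₀ + i x₁` attached to a point `x ∈ ℝ²` (local notation). -/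
local notation:max "cx " x:max => (Complex.mk (x 0) (x 1))

/-- The complex number `x₁ + i x₀` attached to a point `x ∈ ℝ²` (swapped; local notation). -/
local notation:max "cxs " x:max => (Complex.mk (x 1) (x 0))

variable {ρ R' : ℝ} {g : ℂ → ℂ}

section Boundary

/-- `γ(s) = ρ (1 + i s)/(1 - i s)` (local notation; `ρ` is the section variable). -/
local notation:max "γc " s:max => ((ρ : ℂ) * (1 + ((s : ℝ) : ℂ) * Complex.I) / (1 - ((s : ℝ) : ℂ) * Complex.I))

/-- `γ'(s) = 2 i ρ/(1 - i s)²` (local notation). -/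
local notation:max "γc' " s:max => ((ρ : ℂ) * (2 * Complex.I) / (1 - ((s : ℝ) : ℂ) * Complex.I) ^ 2)

/-- Semialgebraicity of the swapped edge maps `y ↦ (±√(ρ² - y²), y)`. -/
theorem isSemialgebraicMapOn_edge' (halg : IsAlgebraic ℚ ρ) {E : Set (Fin 1 → ℝ)}
    (hE : IsSemialgebraic ℚ E) (σ : ℝ) (hσ : σ = 1 ∨ σ = -1) :
    IsSemialgebraicMapOn ℚ E fun y : Fin 1 → ℝ => (![σ * √(ρ ^ 2 - y 0 ^ 2), y 0] : Fin 2 → ℝ) := by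
  have hsq : IsSemialgebraicFunOn ℚ E fun y : Fin 1 → ℝ => √(ρ ^ 2 - y 0 ^ 2) :=
    IsSemialgebraicFunOn.sqrt_holds (IsSemialgebraicFunOn.sub_holds
      (isSemialgebraicFunOn_const_of_isAlgebraic hE (halg.pow 2))
      ((isSemialgebraicFunOn_aeval hE (X 0 ^ 2)).congr fun u _ => by simp))
  refine IsSemialgebraicMapOn.of_forall hE fun j => ?_
  fin_cases j
  · rcases hσ with rfl | rfl
    · simpa using hsq
    · exact hsq.neg.congr fun u _ => by simp
  · exact (isSemialgebraicFunOn_aeval hE (X 0)).congr fun u _ => by simp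

/-- **The `Im g · dv` half of the boundary.** With `rQ = [ℝ, s ↦ -(Im g(γ s) · Im γ'(s))]` and
`rd' = [τ, y ↦ Im g(b y, y) − Im g(−b y, y)]`, `[rQ] + [rd'] ∈ KZ.relations`: split
`ℝ = {s² ≤ 1} ∪ {s² ≥ 1}` (rule (1a)), substitute `y = Im γ(s)` on each piece (rule (2); right
half-circle for `s² ≤ 1`, left for `s² ≥ 1`, whose image misses the null point `y = 0`), add the
integrands on `τ` (rule (1b)) and compare with `rd'`. -/
theorem boundaryQ (hρ : 0 < ρ) (halg : IsAlgebraic ℚ ρ) (hR : ρ < R')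
    (hg : DifferentiableOn ℂ g (ball 0 R'))
    (hQs : IsSemialgebraicFunOn ℚ {x : Fin 2 → ℝ | x 0 ^ 2 + x 1 ^ 2 ≤ ρ ^ 2}
      (fun x => (g (cx x)).im))
    (rQ : IntegralRep 1) (hQd : rQ.domain = univ)
    (hQi : ∀ z, rQ.integrand z = -((g (γc (z 0))).im * (γc' (z 0)).im))
    (rd' : IntegralRep 1) (hdd : rd'.domain = {u : Fin 1 → ℝ | u 0 ^ 2 ≤ ρ ^ 2})
    (hdi : rd'.integrand = fun u => (g ⟨√(ρ ^ 2 - u 0 ^ 2), u 0⟩).im -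
        (g ⟨-√(ρ ^ 2 - u 0 ^ 2), u 0⟩).im) :
    of rQ + of rd' ∈ relations := by
  set τ : Set (Fin 1 → ℝ) := {u | u 0 ^ 2 ≤ ρ ^ 2} with hτ
  set D : Set (Fin 2 → ℝ) := {x | x 0 ^ 2 + x 1 ^ 2 ≤ ρ ^ 2} with hD
  have hτs : IsSemialgebraic ℚ τ := isSemialgebraic_tau halg
  have hτc : IsCompact τ := isCompact_tau ρ
  -- the two pieces of the parameter line
  set B1 : Set (Fin 1 → ℝ) := {z | z 0 ^ 2 ≤ 1} with hB1
  set B2 : Set (Fin 1 → ℝ) := {z | 1 ≤ z 0 ^ 2} with hB2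
  have hB1s : IsSemialgebraic ℚ B1 := by
    have h := isSemialgebraic_setOf_eval_le (k := ℚ) (R := ℝ) (X 0 ^ 2 : MvPolynomial (Fin 1) ℚ) 1
    have hset : {x : Fin 1 → ℝ | aeval x (X 0 ^ 2 : MvPolynomial (Fin 1) ℚ) ≤
        aeval x (1 : MvPolynomial (Fin 1) ℚ)} = B1 := by
      ext z; simp only [mem_setOf_eq, map_pow, aeval_X, map_one, hB1]
    rw [hset] at h; exact h
  have hB2s : IsSemialgebraic ℚ B2 := by
    have h := isSemialgebraic_setOf_eval_le (k := ℚ) (R := ℝ) 1 (X 0 ^ 2 : MvPolynomial (Fin 1) ℚ)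
    have hset : {x : Fin 1 → ℝ | aeval x (1 : MvPolynomial (Fin 1) ℚ) ≤
        aeval x (X 0 ^ 2 : MvPolynomial (Fin 1) ℚ)} = B2 := by
      ext z; simp only [mem_setOf_eq, map_pow, aeval_X, map_one, hB2]
    rw [hset] at h; exact h
  have hB1sub : B1 ⊆ rQ.domain := by rw [hQd]; exact subset_univ _
  have hB2sub : B2 ⊆ rQ.domain := by rw [hQd]; exact subset_univ _
  set rQ1 := rQ.restrict B1 hB1s hB1sub with hrQ1
  set rQ2 := rQ.restrict B2 hB2s hB2sub with hrQ2
  have h1a : of rQ - of rQ1 - of rQ2 ∈ relations := by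
    refine domainAddRel_subset_relations ⟨1, rQ, rQ1, rQ2, ?_, ?_, fun _ _ => rfl, fun _ _ => rfl, rfl⟩
    · rw [hQd]; ext z
      simp only [mem_univ, true_iff, mem_union]
      exact le_total (z 0 ^ 2) 1
    · refine measure_mono_null (fun z hz => ?_) (measure_union_null
        (volume_setOf_last_eq_zero (n := 0) 1) (volume_setOf_last_eq_zero (n := 0) (-1)))
      simp only [mem_inter_iff] at hz
      have h : z 0 ^ 2 = 1 := le_antisymm hz.1 hz.2
      have h' : (z 0 - 1) * (z 0 + 1) = 0 := by nlinarith
      rcases mul_eq_zero.1 h' with h' | h'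
      · exact Or.inl (show z 0 = 1 by linarith)
      · exact Or.inr (show z 0 = -1 by linarith)
  -- the punctured interval
  set τ0 : Set (Fin 1 → ℝ) := τ ∩ {y | y 0 ≠ 0} with hτ0
  have hτ0s : IsSemialgebraic ℚ τ0 := hτs.inter (by
    simpa using isSemialgebraic_setOf_eval_ne_zero (k := ℚ) (R := ℝ) (X 0 : MvPolynomial (Fin 1) ℚ))
  -- edge maps and the target integrands
  have hedge : ∀ σ : ℝ, σ = 1 ∨ σ = -1 → MapsTo
      (fun y : Fin 1 → ℝ => (![σ * √(ρ ^ 2 - y 0 ^ 2), y 0] : Fin 2 → ℝ)) τ D := by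
    intro σ hσ y hy
    have hσ2 : σ ^ 2 = 1 := by rcases hσ with rfl | rfl <;> norm_num
    show (σ * √(ρ ^ 2 - y 0 ^ 2)) ^ 2 + y 0 ^ 2 ≤ ρ ^ 2
    rw [mul_pow, hσ2, one_mul, Real.sq_sqrt (by simp only [hτ, mem_setOf_eq] at hy; linarith)]
    linarith
  have hsa_edge : ∀ σ : ℝ, σ = 1 ∨ σ = -1 →
      IsSemialgebraicFunOn ℚ τ fun y => (g ⟨σ * √(ρ ^ 2 - y 0 ^ 2), y 0⟩).im := fun σ hσ =>
    (IsSemialgebraicFunOn.comp_isSemialgebraicMapOn_holds hQs (isSemialgebraicMapOn_edge' halg hτs σ hσ)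
      (hedge σ hσ)).congr fun y _ => rfl
  have hcont_edge : ∀ σ : ℝ, σ = 1 ∨ σ = -1 →
      ContinuousOn (fun y : Fin 1 → ℝ => (g ⟨σ * √(ρ ^ 2 - y 0 ^ 2), y 0⟩).im) τ := by
    intro σ hσ
    have hm : Continuous fun y : Fin 1 → ℝ => (![σ * √(ρ ^ 2 - y 0 ^ 2), y 0] : Fin 2 → ℝ) := by
      refine continuous_pi fun i => ?_
      fin_cases i
      · exact (continuous_const.mul ((continuous_const.sub ((continuous_apply 0).pow 2)).sqrt))
      · exact continuous_apply 0
    exact (Complex.continuous_im.comp_continuousOn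
      ((continuousOn_g_cx hρ hR hg).comp hm.continuousOn (hedge σ hσ))).congr fun y _ => rfl
  have hint_edge : ∀ σ : ℝ, σ = 1 ∨ σ = -1 →
      IntegrableOn (fun y : Fin 1 → ℝ => (g ⟨σ * √(ρ ^ 2 - y 0 ^ 2), y 0⟩).im) τ := fun σ hσ =>
    (hcont_edge σ hσ).integrableOn_compact hτc
  let rQ1' : IntegralRep 1 := ⟨τ, fun y => -(g ⟨1 * √(ρ ^ 2 - y 0 ^ 2), y 0⟩).im, hτs,
    (hsa_edge 1 (Or.inl rfl)).neg, (hint_edge 1 (Or.inl rfl)).neg⟩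
  let rQ2'' : IntegralRep 1 := ⟨τ, fun y => (g ⟨(-1) * √(ρ ^ 2 - y 0 ^ 2), y 0⟩).im, hτs,
    hsa_edge (-1) (Or.inr rfl), hint_edge (-1) (Or.inr rfl)⟩
  set rQ2' := rQ2''.restrict τ0 hτ0s inter_subset_left with hrQ2'
  -- facts about `v = Im γ`
  have hU : ∀ s : ℝ, (γc s).re = ρ * (1 - s ^ 2) / (1 + s ^ 2) := fun s => gamma_re ρ s
  have hV : ∀ s : ℝ, (γc s).im = 2 * ρ * s / (1 + s ^ 2) := fun s => gamma_im ρ s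
  have hV' : ∀ s : ℝ, (γc' s).im = 2 * ρ * (1 - s ^ 2) / (1 + s ^ 2) ^ 2 := fun s => gamma'_im ρ s
  have hcirc : ∀ s : ℝ, (γc s).im ^ 2 + (γc s).re ^ 2 = ρ ^ 2 := fun s => by
    rw [hU, hV, add_comm]; exact u_sq_add_v_sq ρ s
  have hsaV : ∀ {A : Set (Fin 1 → ℝ)}, IsSemialgebraic ℚ A →
      IsSemialgebraicFunOn ℚ A fun z => (γc (z 0)).im := fun hA =>
    ((isSemialgebraicMapOn_iff_forall_holds hA).1 (isSemialgebraicMapOn_gamma halg hA) 1).congr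
      fun z _ => by simp
  -- the two substitutions
  have hcov1 : of rQ1 - of rQ1' ∈ relations := by
    refine cov1 rQ1 rQ1' (fun s => (γc s).im) (fun s => (γc' s).im) (hsaV hB1s)
      (fun z _ => hasDerivAt_gamma_im ρ (z 0)) (fun z hz z' hz' h => ?_) ?_ (fun z hz => ?_)
    · rw [hV, hV] at h
      have hz0 : z 0 ^ 2 ≤ 1 := hz; have hz0' : z' 0 ^ 2 ≤ 1 := hz'
      rcases eq_or_mul_eq_one_of_v_eq hρ.ne' h with h2 | h2
      · exact h2
      · have h3 : (z 0 - z' 0) ^ 2 ≤ 0 := by nlinarith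
        have h4 : (z 0 - z' 0) ^ 2 = 0 := le_antisymm h3 (sq_nonneg _)
        exact sub_eq_zero.1 (pow_eq_zero_iff two_ne_zero |>.1 h4)
    · show τ = _
      ext y
      constructor
      · intro hy
        have hy' : y 0 ^ 2 ≤ ρ ^ 2 := hy
        obtain ⟨h1, h2⟩ := v_inv1 hρ hy'
        refine ⟨fun _ => y 0 / (ρ + √(ρ ^ 2 - y 0 ^ 2)), h1, ?_⟩
        funext i
        beta_reduce
        rw [hV, Subsingleton.elim i 0]
        exact h2
      · rintro ⟨z, -, rfl⟩
        show (γc (z 0)).im ^ 2 ≤ ρ ^ 2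
        rw [hV]; exact v_sq_le (z 0)
    · have hz0 : z 0 ^ 2 ≤ 1 := hz
      show rQ.integrand z = -(g ⟨1 * √(ρ ^ 2 - (γc (z 0)).im ^ 2), (γc (z 0)).im⟩).im * |(γc' (z 0)).im|
      have hre : 0 ≤ (γc (z 0)).re := by
        rw [hU]; exact div_nonneg (by nlinarith) (by positivity)
      have hpt : (⟨1 * √(ρ ^ 2 - (γc (z 0)).im ^ 2), (γc (z 0)).im⟩ : ℂ) = γc (z 0) :=
        Complex.ext (by rw [one_mul]; exact (eq_sqrt_of_sq_add_sq (hcirc (z 0)) hre).symm) rfl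
      have hder : 0 ≤ (γc' (z 0)).im := by
        rw [hV']; exact div_nonneg (by nlinarith) (by positivity)
      rw [hpt, abs_of_nonneg hder, hQi]
      ring
  have hcov2 : of rQ2 - of rQ2' ∈ relations := by
    refine cov1 rQ2 rQ2' (fun s => (γc s).im) (fun s => (γc' s).im) (hsaV hB2s)
      (fun z _ => hasDerivAt_gamma_im ρ (z 0)) (fun z hz z' hz' h => ?_) ?_ (fun z hz => ?_)
    · rw [hV, hV] at h
      have hz0 : 1 ≤ z 0 ^ 2 := hz; have hz0' : 1 ≤ z' 0 ^ 2 := hz'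
      rcases eq_or_mul_eq_one_of_v_eq hρ.ne' h with h2 | h2
      · exact h2
      · have hp : z 0 ^ 2 * z' 0 ^ 2 = 1 := by rw [← mul_pow, h2, one_pow]
        have h3 : (z 0 - z' 0) ^ 2 ≤ 0 := by
          nlinarith [mul_nonneg (sub_nonneg.2 hz0) (sub_nonneg.2 hz0')]
        have h4 : (z 0 - z' 0) ^ 2 = 0 := le_antisymm h3 (sq_nonneg _)
        exact sub_eq_zero.1 (pow_eq_zero_iff two_ne_zero |>.1 h4)
    · show τ0 = _
      ext y
      constructor
      · rintro ⟨hy, hy0⟩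
        have hy' : y 0 ^ 2 ≤ ρ ^ 2 := hy
        have hy0' : y 0 ≠ 0 := hy0
        obtain ⟨h1, h2⟩ := v_inv2 hρ hy' hy0'
        refine ⟨fun _ => (ρ + √(ρ ^ 2 - y 0 ^ 2)) / y 0, h1, ?_⟩
        funext i
        beta_reduce
        rw [hV, Subsingleton.elim i 0]
        exact h2
      · rintro ⟨z, hz, rfl⟩
        have hz1 : 1 ≤ z 0 ^ 2 := hz
        refine ⟨?_, ?_⟩
        · show (γc (z 0)).im ^ 2 ≤ ρ ^ 2
          rw [hV]; exact v_sq_le (z 0)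
        · show (γc (z 0)).im ≠ 0
          rw [hV]
          have hz0 : z 0 ≠ 0 := fun h => by rw [h] at hz1; norm_num at hz1
          have hd : (0 : ℝ) < 1 + z 0 ^ 2 := by positivity
          exact div_ne_zero (mul_ne_zero (mul_ne_zero two_ne_zero hρ.ne') hz0) hd.ne'
    · have hz1 : 1 ≤ z 0 ^ 2 := hz
      show rQ.integrand z = (g ⟨(-1) * √(ρ ^ 2 - (γc (z 0)).im ^ 2), (γc (z 0)).im⟩).im * |(γc' (z 0)).im|
      have hre : (γc (z 0)).re ≤ 0 := by
        rw [hU]; exact div_nonpos_of_nonpos_of_nonneg (by nlinarith) (by positivity)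
      have hpt : (⟨(-1) * √(ρ ^ 2 - (γc (z 0)).im ^ 2), (γc (z 0)).im⟩ : ℂ) = γc (z 0) :=
        Complex.ext (by rw [neg_one_mul]; exact (eq_neg_sqrt_of_sq_add_sq (hcirc (z 0)) hre).symm) rfl
      have hder : (γc' (z 0)).im ≤ 0 := by
        rw [hV']; exact div_nonpos_of_nonpos_of_nonneg (by nlinarith) (by positivity)
      rw [hpt, abs_of_nonpos hder, hQi]
      ring
  -- restriction to the punctured interval, addition, comparison with `rd'`
  have hres2 : of rQ2'' - of rQ2' ∈ relations := by
    refine rQ2''.of_sub_of_restrict_mem_relations hτ0s inter_subset_left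
      (measure_mono_null (fun y hy => ?_) (volume_setOf_last_eq_zero (n := 0) 0))
    obtain ⟨hy1, hy2⟩ := hy
    show y 0 = 0
    by_contra h
    exact hy2 ⟨hy1, h⟩
  let rE : IntegralRep 1 := ⟨τ, rQ1'.integrand + rQ2''.integrand, hτs,
    IsSemialgebraicFunOn.add_holds rQ1'.isSemialgebraicFunOn_integrand
      rQ2''.isSemialgebraicFunOn_integrand, rQ1'.integrableOn.add rQ2''.integrableOn⟩
  have h1b : of rE - of rQ1' - of rQ2'' ∈ relations :=
    integrandAddRel_subset_relations ⟨1, rE, rQ1', rQ2'', rfl, rfl, fun _ _ => rfl, rfl⟩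
  have hneg : of rd' + of rE ∈ relations := by
    refine of_add_of_mem_relations_of_eqOn_neg (show τ = rd'.domain by rw [hdd]) fun y _ => ?_
    show -(g ⟨1 * √(ρ ^ 2 - y 0 ^ 2), y 0⟩).im + (g ⟨(-1) * √(ρ ^ 2 - y 0 ^ 2), y 0⟩).im =
      -rd'.integrand y
    rw [hdi, one_mul, neg_one_mul]
    ring
  have : of rQ + of rd' = (of rQ - of rQ1 - of rQ2) + (of rQ1 - of rQ1') + (of rQ2 - of rQ2') -
      (of rQ2'' - of rQ2') - (of rE - of rQ1' - of rQ2'') + (of rd' + of rE) := by abel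
  rw [this]
  exact relations.add_mem (relations.sub_mem (relations.sub_mem (relations.add_mem
    (relations.add_mem h1a hcov1) hcov2) hres2) h1b) hneg

end Boundary

end Summit.KontsevichZagierPeriods.ComplexOrientations.CauchyMoveAux
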